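import Literature.NumberTheory.ComplexMultiplication.CosetGermWeilOrbitBijection
import HarnessLib

/-!
# Milne 1999 §6 p. 70 L5–L10 (Lemma 6.7, bottom arrow) FOR THE CM FIELD `K`: `X^*(L^Π)` of the orbit `Π = Γπ₀ ⊂ W(p^∞)` IS the model's
# `X^*(L^Π) = CharModule ℤ (Γ/D) ι` along «`τ ↦ τπ₀` … a bijection `Γ/D → Π`», `X^*(β^Π)` IS the model's `X^*(β)`, and LEMMA 6.7's
# conclusion «the bottom map is injective» for `K`'s own `X^*(β^Π) : X^*(L^Π) → X^*(P^K)`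

THE PRINT. [Milne1999, §6 p. 70 L1–L12]: «LEMMA 6.7. The diagram [`X^*(T^Ψ) −X^*(γ)→ X^*(S^K)` over `X^*(L^Π) −X^*(β)→ X^*(P^K)`, verticals
`X^*(α′)`, `X^*(α)`] becomes almost Cartesian when the two groups at right are replaced by the images of the horizontal arrows.  Proof. We shall
prove this by showing that the bottom map is injective. The map `τ ↦ τπ₀` defines a bijection `Γ/D → Π`, and hence an isomorphism `ℤ[Γ/D] →
ℤ[Π]`. On combining this with the natural map `ℤ[Π] → X^*(L^Π)`, we get the first map in the sequence `ℤ[Γ/D] → X^*(L^Π) −X^*(β)→ X^*(P^K) →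
ℤ[Γ/D]`. The map at right sends `π` to the map `σ ↦ f_π(σw₀)`—it is injective (Section 4).»  Here `Π = Γπ₀ ⊂ W^K_{1,+}(p^∞)`, `π₀ = π(ψ₀)`
(p. 69 L26–L28), `X^*(L^Π) = {f : Π → ℤ}/{f = ιf, Σ f(π) = 0}` (§4 p. 60), `X^*(β)[δ_π] = π` (§4 p. 62 L17–L19).

DICTIONARY (tree ↔ print).  For the CM field `K` (g15-#3/g16-#7, namespace `CMNumbers`): `X^*(L^Π) = weilOrbitChar ℤ ϖ = OrbitTorus.CharModule ℤ
(Gal(ℚ^{cm}/ℚ)·ϖ) ι_{cm}` for a germ `ϖ ∈ W(p^∞) = WeilLimit p`, `l^Π = lWeil`, `X^*(β^Π) = betaCharIn p τ₀ ϖ hϖ : X^*(L^Π) → X^*(P^K) = Additive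
(weilLimitIn K p τ₀)`, `[δ_π] ↦ π` (`betaCharIn_mk_single`); g18-#2 `germToCosetFun : X^*(P^K) ↪ ℤ[Γ/D]`, `π ↦ f_π` («The map at right …»).  In
the model (g17-#3, namespace `CosetGerm`): `X^*(L^Π) := CharModule R (Γ ⧸ D) ι` READ THROUGH «`Π ≅ Γ/D`», `X^*(β) = betaPi R h h2`, `[δ_{τD}] ↦
f_{τπ₀} = germ (τD)` (`betaPi_mk_single`), and LEMMA 6.7's conclusion `betaPi_injective` (g17-#2 `injective_of_hasPrintedValues`, `n ≠ 2`).  g18-#4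
supplies `π₀ = piZero ∈ X^*(P^K)`, its orbit `weilOrbitPiZero ≃ Γ/D(w₀)` (`quotientEquivWeilOrbitPiZero`) and `germ = τD ↦ f_{τπ₀}`
(`germ_eq_coe_piGerm`).  HERE: **`varpiZero`** = `ϖ₀`, the germ of `π₀` in `W(p^∞)` (g16-#6 `cmTypeGerm` of `Φ₀`), its orbit `Gal(ℚ^{cm}/ℚ)·ϖ₀ ⊂
W(p^∞)` = «`Π`» as g15-#3 indexes it, **`orbitVarpiZeroEquivQuotient : Π ≃ Γ ⧸ D(w₀)`**, **`weilOrbitCharEquiv : X^*(L^Π)(K) ≃ₗ[ℤ] CharModule ℤ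
(Γ ⧸ D) ι`** («hence an isomorphism `ℤ[Γ/D] → ℤ[Π]`», passed to the quotients), and **`germToCosetFun_betaCharIn`**: `K`'s `X^*(β^Π)` followed by
`π ↦ f_π` IS the model's `betaPi` — so **`betaCharIn_varpiZero_injective`** = LEMMA 6.7's «the bottom map is injective» for `K`'s own
`X^*(β^Π) : X^*(L^Π) → X^*(P^K)`.

WHAT IS HERE.  §0 (namespace `OrbitTorus`, generic): `transfer_act_of_forall`, `transfer_mem_rel_of_forall`, `map_rel_eq_of_forall`, DEF **`congr₂ : CharModule R S ι ≃ₗ[R] CharModule R S′ ι′`** for an `ι ↔ ι′`-compatible bijection `S ≃ S′` of sets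
acted on by two (different) groups (`congr₂_mk`, `congr₂_mk_single`, `congr₂_tChar`, `congr₂_rep`) — Q731's `congr` is the one-group case.
§1 (namespace `CMNumbers`; `Γ = Gal(K/ℚ)`, `ι = conjGal`, `D = decompositionGroup p 𝔭`, any `Γ₀` with `h : Setting conjGal Γ₀ D`):
`cmNumbersConj_smul_eq_embOfAut_conjGal` (`ι_{cm}|_K = ι`), `mul_smul_eq_embOfAut_mul`, DEF **`varpiZero`** (`coe_toMul_piZero`,
`varpiZero_mem_weilLimitInOnePlus`, `varpiZero_mem_weilLimitIn`), `ofMul_eq_weilLimitInRep_piZero`, DEF `orbitVarpiZeroEquiv : Γϖ₀ ≃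
weilOrbitPiZero` (`coe_toMul_orbitVarpiZeroEquiv`, `coe_orbitVarpiZeroEquiv_symm`), DEF **`orbitVarpiZeroEquivQuotient : Γϖ₀ ≃ Γ ⧸ D`**
(`orbitVarpiZeroEquivQuotient_apply : σ′ϖ₀ ↦ ρD`, `…_smul` (equivariance along `σ′ ↦ σ′|_K`), `…_conj_smul`), DEF **`weilOrbitCharEquiv`**
(`weilOrbitCharEquiv_mk_single`, **`weilOrbitCharEquiv_lWeil : l^Π ↦ [δ_D + δ_{ιD}]`**, **`weilOrbitCharEquiv_weilOrbitRep`** (equivariance)); §2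
**`germToCosetFun_betaCharIn`**, **`betaCharIn_varpiZero_injective`** (LEMMA 6.7's conclusion for `K`, `n = |Γ₀| ≠ 2`); §3
`betaCharIn_varpiZero_injective_of_split` (`K = Q·F`, `p` split in `Q`, `[K : Q] ≠ 2`, at g18-#1 `cosetGermSetting`).

SCOPE / NOT HERE.  (1) `n ≠ 2` as in g17-#2/#3 and g18-#4 (for `n = 2` the printed bijection `Γ/D → Π` fails, see g18-#4's docstring).  (2) Only the
orbit `Π` of `π₀ = π(ψ₀)`; the orbit `Π̄ = {π̄, ιπ̄}` of Lemma 6.8 and the other orbits of `W^K_{1,+}(p^∞)` (Lemma 6.10's index set `I′`) are not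
treated here, nor is the `T`-side `X^*(T^Ψ)(K) ≅ CharModule ℤ Γ ι` with `X^*(γ^Ψ)`, `X^*(α′)`; hence Lemma 6.7's almost-Cartesian packaging and
Lemmas 6.9/6.10 / Theorem 6.1 for `K`'s own `T`- and `L`-vertices are NOT claimed (model: g17-#3…#5; `S`/`P`-vertices for `K`: g18-#3).
(3) Nothing here is a case of the Hodge conjecture; Theorem 6.1 on group schemes / the limit over `K` is Layer B (B5-09).

## References
* [Milne1999] J. S. Milne, *Lefschetz motives and the Tate conjecture*, Compositio Math. 117 (1999) 45–76, §6 p. 70 (Lemma 6.7), §4 pp. 60–62.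

## Provenance
lit-hodgefound seat p27, generation 18, row g18-#5 (Milne 1999 §6 Lemma 6.7's bottom arrow for the CM field `K`).
-/

set_option autoImplicit false

noncomputable section

open scoped NumberField Pointwise

namespace Literature.NumberTheory.ComplexMultiplication

/-! ### §0 Transport of `CharModule` along an `ι ↔ ι′`-compatible bijection of sets acted on by two different groups -/

namespace OrbitTorus

section Transport₂

variable (R : Type*) [CommRing R] {G G' : Type*} [Group G] [Group G'] {S S' : Type*} [MulAction G S] [MulAction G' S']
  (ι : G) (ι' : G') (e : S ≃ S') (he : ∀ s : S, e (ι • s) = ι' • e s)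

/-- A relabelling `e : S ≃ S′` intertwines the translations by `g ∈ G` and `g′ ∈ G′` when `e(gs) = g′e(s)`. [cite: Milne1999, §2 p. 56 L19–L22] -/
theorem transfer_act_of_forall {g : G} {g' : G'} (hg : ∀ s : S, e (g • s) = g' • e s) (f : S →₀ R) :
    transfer R e (act R g f) = act R g' (transfer R e f) := by
  induction f using Finsupp.induction_linear with
  | zero => simp
  | add f₁ f₂ h₁ h₂ => simp only [map_add, h₁, h₂]
  | single s n => rw [act_single, transfer_single, transfer_single, act_single, hg]

include he in
/-- An `ι ↔ ι′`-compatible bijection carries `{f = ιf, Σ f = 0}` into `{f′ = ι′f′, Σ f′ = 0}`. [cite: Milne1999, §2 p. 56 L19–L22] -/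
theorem transfer_mem_rel_of_forall {f : S →₀ R} (hf : f ∈ rel R S ι) : transfer R e f ∈ rel R S' ι' := by
  rw [mem_rel_iff] at hf ⊢
  exact ⟨by rw [← transfer_act_of_forall R e he, hf.1], by rw [aug_transfer, hf.2]⟩

include he in
/-- The inverse bijection is `ι′ ↔ ι`-compatible. [folklore] -/
private theorem symm_apply_iota_smul (s' : S') : e.symm (ι' • s') = ι • e.symm s' :=
  e.injective (by rw [he, e.apply_symm_apply, e.apply_symm_apply])

include he in
/-- [cite: Milne1999, §2 p. 56 L19–L22] -/
theorem map_rel_eq_of_forall : (rel R S ι).map (transfer R e).toLinearMap = rel R S' ι' := by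
  refine le_antisymm (Submodule.map_le_iff_le_comap.mpr fun f hf ↦ transfer_mem_rel_of_forall R ι ι' e he hf) fun f' hf' ↦ ?_
  refine Submodule.mem_map.mpr
    ⟨transfer R e.symm f', transfer_mem_rel_of_forall R ι' ι e.symm (symm_apply_iota_smul ι ι' e he) hf', ?_⟩
  rw [LinearEquiv.coe_coe, ← transfer_symm_apply]
  exact (transfer R e).apply_symm_apply f'

/-- **Transport of character modules along an `ι ↔ ι′`-compatible bijection `e : S ≃ S′` of sets acted on by two (possibly different)
groups** — `X(S, ι) ≅ X(S′, ι′)`, `[δ_s] ↦ [δ_{e s}]` (Q731's `congr` is the one-group case). [cite: Milne1999, §2 p. 56 L19–L22] -/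
def congr₂ : CharModule R S ι ≃ₗ[R] CharModule R S' ι' :=
  Submodule.Quotient.equiv (rel R S ι) (rel R S' ι') (transfer R e) (map_rel_eq_of_forall R ι ι' e he)

/-- [cite: Milne1999, §2 p. 56 L19–L22] -/
@[simp] theorem congr₂_mk (f : S →₀ R) : congr₂ R ι ι' e he (Submodule.Quotient.mk f) = Submodule.Quotient.mk (transfer R e f) := rfl

/-- `[δ_s] ↦ [δ_{e s}]`. [cite: Milne1999, §2 p. 56 L19–L22] -/
theorem congr₂_mk_single (s : S) (r : R) :
    congr₂ R ι ι' e he (Submodule.Quotient.mk (Finsupp.single s r)) = Submodule.Quotient.mk (Finsupp.single (e s) r) := by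
  rw [congr₂_mk, transfer_single]

/-- `t ↦ t′`: `[δ_{s₀} + δ_{ιs₀}] ↦ [δ_{e s₀} + δ_{ι′e s₀}]`. [cite: Milne1999, §2 p. 56 L19–L22] -/
theorem congr₂_tChar (s₀ : S) : congr₂ R ι ι' e he (tChar R ι s₀) = tChar R ι' (e s₀) := by
  rw [tChar, congr₂_mk, map_add, transfer_single, transfer_single, he]
  rfl

/-- Transport intertwines the actions of `g ∈ G` and `g′ ∈ G′` when `e(gs) = g′e(s)` (`ι`, `ι′` central). [cite: Milne1999, §2 p. 56 L19–L22] -/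
theorem congr₂_rep (hc : ∀ g : G, ι * g = g * ι) (hc' : ∀ g' : G', ι' * g' = g' * ι') {g : G} {g' : G'}
    (hg : ∀ s : S, e (g • s) = g' • e s) (x : CharModule R S ι) :
    congr₂ R ι ι' e he (rep R S ι hc g x) = rep R S' ι' hc' g' (congr₂ R ι ι' e he x) := by
  induction x using Submodule.Quotient.induction_on with | H f => ?_
  rw [rep_mk, congr₂_mk, congr₂_mk, rep_mk, transfer_act_of_forall R e hg]

end Transport₂

end OrbitTorus

/-! ### §1 The orbit `Π ⊂ W(p^∞)` of the germ `ϖ₀ = π(Φ₀)`, `Π ≃ Γ/D(w₀)`, and `X^*(L^Π) ≅ CharModule ℤ (Γ/D) ι` -/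

namespace CMNumbers

open _root_.NumberField IntermediateField Finset
open Literature.NumberTheory.NumberFields (cmNumbers cmNumbersConj cmNumbersConj_mul_comm)
open OrbitTorus (pushFun act)
open CosetGerm (Setting WeilGerms piGerm)

section Orbit

variable {K : Type} [Field K] [NumberField K] [IsCMField K] [IsGalois ℚ K]
variable (p : ℕ) [hp : Fact p.Prime] (𝔭 : Ideal (𝓞 K)) [h𝔭P : 𝔭.IsPrime] [h𝔭 : 𝔭.LiesOver (Ideal.span {(p : ℤ)})]
variable (τ₀ : K →ₐ[ℚ] cmNumbers)
variable {Γ₀ : Subgroup (K ≃ₐ[ℚ] K)} (h : Setting (conjGal : K ≃ₐ[ℚ] K) Γ₀ (decompositionGroup p 𝔭))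
variable [DecidableEq (K ≃ₐ[ℚ] K)] [DecidablePred (· ∈ Γ₀)]

omit [IsGalois ℚ K] [DecidableEq (K ≃ₐ[ℚ] K)] in
/-- `ι_{cm}` restricts to `ι` on `K`: `ι_{cm} ∘ τ₀ = τ₀ ∘ conjGal` (g16-#3 `cmNumbersConj_smul_embOfAut` at `σ = 1`). [cite: Milne1999, §6 p. 69 L1–L6] -/
theorem cmNumbersConj_smul_eq_embOfAut_conjGal : cmNumbersConj • τ₀ = embOfAut τ₀ (conjGal : K ≃ₐ[ℚ] K) := by
  rw [← mul_one (conjGal : K ≃ₐ[ℚ] K), ← cmNumbersConj_smul_embOfAut, embOfAut_one]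

omit [IsCMField K] [IsGalois ℚ K] [DecidableEq (K ≃ₐ[ℚ] K)] in
/-- Restrictions multiply: if `σ′τ₀ = τ₀ρ` and `σ″τ₀ = τ₀ρ″` then `(σ″σ′)τ₀ = τ₀(ρ″ρ)`. [cite: Milne1999, §6 p. 69 L1 («Γ = Gal(K/ℚ)»)] -/
theorem mul_smul_eq_embOfAut_mul {σ' σ'' : cmNumbers ≃ₐ[ℚ] cmNumbers} {ρ ρ'' : K ≃ₐ[ℚ] K} (hρ : σ' • τ₀ = embOfAut τ₀ ρ)
    (hρ'' : σ'' • τ₀ = embOfAut τ₀ ρ'') : (σ'' * σ') • τ₀ = embOfAut τ₀ (ρ'' * ρ) := by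
  rw [mul_smul, hρ, embOfAut_mul, ← hρ'']
  rfl

/-- **`ϖ₀ = π(Φ₀) ∈ W^K_{1,+}(p^∞) ⊂ W(p^∞)`**, the germ of `π₀` (g16-#6 `cmTypeGerm` of `Φ₀ = {τ₀} ∪ τ₀ι(Γ₀∖1)`); `π₀ = piZero` of g18-#4 is
`ϖ₀` as an element of `X^*(P^K) = Additive (weilLimitIn K p τ₀)`. [cite: Milne1999, §6 p. 69 L26–L27] -/
def varpiZero : WeilLimit p := cmTypeGerm p 𝔭 (isCMTypeWith_ofCMTypes τ₀ h (CosetGerm.psiType h))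

/-- [cite: Milne1999, §6 p. 69 L26–L27] -/
theorem coe_toMul_piZero : ((Additive.toMul (piZero p 𝔭 τ₀ h) : weilLimitIn K p τ₀) : WeilLimit p) = varpiZero p 𝔭 τ₀ h :=
  coe_toMul_alphaCharIn_cmTypeChar p 𝔭 τ₀ _

/-- `ϖ₀ ∈ W^K_{1,+}(p^∞)` (g16-#6). [cite: Milne1999, §6 p. 69 L26–L27] -/
theorem varpiZero_mem_weilLimitInOnePlus : varpiZero p 𝔭 τ₀ h ∈ weilLimitInOnePlus K p τ₀ :=
  cmTypeGerm_mem_weilLimitInOnePlus p 𝔭 τ₀ _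

/-- `ϖ₀ ∈ W^K(p^∞)`. [cite: Milne1999, §6 p. 69 L26–L27] -/
theorem varpiZero_mem_weilLimitIn : varpiZero p 𝔭 τ₀ h ∈ weilLimitIn K p τ₀ :=
  (varpiZero_mem_weilLimitInOnePlus p 𝔭 τ₀ h).1

/-- An element of the orbit `Π = Γϖ₀ ⊂ W(p^∞)` read in `X^*(P^K)`: `σ′ϖ₀ ↦ σ′π₀`. [cite: Milne1999, §6 p. 69 L26–L28] -/
theorem ofMul_eq_weilLimitInRep_piZero (π : MulAction.orbit (cmNumbers ≃ₐ[ℚ] cmNumbers) (varpiZero p 𝔭 τ₀ h))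
    (σ' : cmNumbers ≃ₐ[ℚ] cmNumbers) (hσ' : σ' • varpiZero p 𝔭 τ₀ h = π) :
    Additive.ofMul (⟨(π : WeilLimit p), coe_orbit_mem_weilLimitIn p τ₀ (varpiZero_mem_weilLimitIn p 𝔭 τ₀ h) π⟩ : weilLimitIn K p τ₀) =
      weilLimitInRep p τ₀ σ' (piZero p 𝔭 τ₀ h) := by
  rw [weilLimitInRep_apply]
  exact congrArg Additive.ofMul (Subtype.ext (by rw [coe_weilLimitInAct, coe_toMul_piZero]; exact hσ'.symm))

/-- **`Π ⊂ W(p^∞)` and `Π ⊂ X^*(P^K)` are the same orbit**: the `Γ`-orbit of the germ `ϖ₀` in `W(p^∞)` ≃ g18-#4's `weilOrbitPiZero` (the orbit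
of `π₀` in `X^*(P^K) = W^K(p^∞)`), `π ↦ π`. [cite: Milne1999, §6 p. 69 L26–L28] -/
def orbitVarpiZeroEquiv : MulAction.orbit (cmNumbers ≃ₐ[ℚ] cmNumbers) (varpiZero p 𝔭 τ₀ h) ≃ weilOrbitPiZero p 𝔭 τ₀ h where
  toFun π := ⟨Additive.ofMul ⟨(π : WeilLimit p), coe_orbit_mem_weilLimitIn p τ₀ (varpiZero_mem_weilLimitIn p 𝔭 τ₀ h) π⟩, by
    obtain ⟨σ', hσ'⟩ := MulAction.mem_orbit_iff.mp π.2
    exact ⟨σ', (ofMul_eq_weilLimitInRep_piZero p 𝔭 τ₀ h π σ' hσ').symm⟩⟩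
  invFun x := ⟨((Additive.toMul x.1 : weilLimitIn K p τ₀) : WeilLimit p), by
    obtain ⟨σ', hσ'⟩ := x.2
    have hσ'' : weilLimitInRep p τ₀ σ' (piZero p 𝔭 τ₀ h) = x.1 := hσ'
    refine MulAction.mem_orbit_iff.mpr ⟨σ', ?_⟩
    rw [← hσ'', weilLimitInRep_apply, toMul_ofMul, coe_weilLimitInAct, coe_toMul_piZero]⟩
  left_inv _ := rfl
  right_inv _ := rfl

/-- [cite: Milne1999, §6 p. 69 L26–L28] -/
@[simp] theorem coe_toMul_orbitVarpiZeroEquiv (π : MulAction.orbit (cmNumbers ≃ₐ[ℚ] cmNumbers) (varpiZero p 𝔭 τ₀ h)) :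
    ((Additive.toMul (orbitVarpiZeroEquiv p 𝔭 τ₀ h π).1 : weilLimitIn K p τ₀) : WeilLimit p) = π := rfl

/-- [cite: Milne1999, §6 p. 69 L26–L28] -/
@[simp] theorem coe_orbitVarpiZeroEquiv_symm (x : weilOrbitPiZero p 𝔭 τ₀ h) :
    ((orbitVarpiZeroEquiv p 𝔭 τ₀ h).symm x : WeilLimit p) = (Additive.toMul x.1 : weilLimitIn K p τ₀) := rfl

variable [DecidablePred (· ∈ decompositionGroup p 𝔭)]

/-- **`Π ≃ Γ/D(w₀)` for the orbit of the germ `ϖ₀` in `W(p^∞)`** («the map `τ ↦ τπ₀` defines a bijection `Γ/D → Π`»; g18-#4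
`quotientEquivWeilOrbitPiZero`), `n = |Γ₀| ≠ 2`. [cite: Milne1999, §6 p. 70 L7–L8] -/
def orbitVarpiZeroEquivQuotient (hn : (univ.filter (· ∈ Γ₀) : Finset (K ≃ₐ[ℚ] K)).card ≠ 2) :
    MulAction.orbit (cmNumbers ≃ₐ[ℚ] cmNumbers) (varpiZero p 𝔭 τ₀ h) ≃ (K ≃ₐ[ℚ] K) ⧸ decompositionGroup p 𝔭 :=
  (orbitVarpiZeroEquiv p 𝔭 τ₀ h).trans (quotientEquivWeilOrbitPiZero p 𝔭 τ₀ h hn).symm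

/-- `σ′ϖ₀ ↦ ρD` for `σ′ ∘ τ₀ = τ₀ ∘ ρ`. [cite: Milne1999, §6 p. 70 L7–L8] -/
theorem orbitVarpiZeroEquivQuotient_apply (hn : (univ.filter (· ∈ Γ₀) : Finset (K ≃ₐ[ℚ] K)).card ≠ 2)
    (π : MulAction.orbit (cmNumbers ≃ₐ[ℚ] cmNumbers) (varpiZero p 𝔭 τ₀ h)) (σ' : cmNumbers ≃ₐ[ℚ] cmNumbers) (ρ : K ≃ₐ[ℚ] K)
    (hρ : σ' • τ₀ = embOfAut τ₀ ρ) (hπ : σ' • varpiZero p 𝔭 τ₀ h = π) :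
    orbitVarpiZeroEquivQuotient p 𝔭 τ₀ h hn π = (ρ : (K ≃ₐ[ℚ] K) ⧸ decompositionGroup p 𝔭) := by
  rw [orbitVarpiZeroEquivQuotient, Equiv.trans_apply, Equiv.symm_apply_eq]
  apply Subtype.ext
  rw [quotientEquivWeilOrbitPiZero_mk p 𝔭 τ₀ h hn σ' ρ hρ]
  exact ofMul_eq_weilLimitInRep_piZero p 𝔭 τ₀ h π σ' hπ

/-- **Equivariance along restriction**: `(σ″π) ↦ ρ″·(image of π)` for `σ″ ∘ τ₀ = τ₀ ∘ ρ″`. [cite: Milne1999, §6 p. 70 L7–L8] -/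
theorem orbitVarpiZeroEquivQuotient_smul (hn : (univ.filter (· ∈ Γ₀) : Finset (K ≃ₐ[ℚ] K)).card ≠ 2)
    (σ'' : cmNumbers ≃ₐ[ℚ] cmNumbers) (ρ'' : K ≃ₐ[ℚ] K) (hρ'' : σ'' • τ₀ = embOfAut τ₀ ρ'')
    (π : MulAction.orbit (cmNumbers ≃ₐ[ℚ] cmNumbers) (varpiZero p 𝔭 τ₀ h)) :
    orbitVarpiZeroEquivQuotient p 𝔭 τ₀ h hn (σ'' • π) = ρ'' • orbitVarpiZeroEquivQuotient p 𝔭 τ₀ h hn π := by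
  obtain ⟨σ', hσ'⟩ := MulAction.mem_orbit_iff.mp π.2
  obtain ⟨ρ, hρ⟩ := exists_smul_eq_embOfAut τ₀ σ'
  rw [orbitVarpiZeroEquivQuotient_apply p 𝔭 τ₀ h hn π σ' ρ hρ hσ',
    orbitVarpiZeroEquivQuotient_apply p 𝔭 τ₀ h hn (σ'' • π) (σ'' * σ') (ρ'' * ρ) (mul_smul_eq_embOfAut_mul τ₀ hρ hρ'')
      (by rw [MulAction.orbit.coe_smul, ← hσ', mul_smul])]
  rfl

/-- `ι_{cm}π ↦ ι·(image of π)`. [cite: Milne1999, §6 p. 70 L7–L8] -/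
theorem orbitVarpiZeroEquivQuotient_conj_smul (hn : (univ.filter (· ∈ Γ₀) : Finset (K ≃ₐ[ℚ] K)).card ≠ 2)
    (π : MulAction.orbit (cmNumbers ≃ₐ[ℚ] cmNumbers) (varpiZero p 𝔭 τ₀ h)) :
    orbitVarpiZeroEquivQuotient p 𝔭 τ₀ h hn (cmNumbersConj • π) =
      (conjGal : K ≃ₐ[ℚ] K) • orbitVarpiZeroEquivQuotient p 𝔭 τ₀ h hn π :=
  orbitVarpiZeroEquivQuotient_smul p 𝔭 τ₀ h hn cmNumbersConj conjGal (cmNumbersConj_smul_eq_embOfAut_conjGal τ₀) π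

/-- **`X^*(L^Π)` OF `K` IS THE MODEL'S `X^*(L^Π)`**: g15-#3's `weilOrbitChar ℤ ϖ₀ = {f : Π → ℤ}/{f = ιf, Σ f = 0}` for the orbit `Π = Γϖ₀ ⊂ W(p^∞)`
is, along `Π ≃ Γ/D` («hence an isomorphism `ℤ[Γ/D] → ℤ[Π]`»), g17-#3's `CharModule ℤ (Γ ⧸ D) ι` — the reading «`X^*(L^Π)`, `Π ≅ Γ/D`» used
there as a dictionary. [cite: Milne1999, §6 p. 70 L7–L10] -/
def weilOrbitCharEquiv (hn : (univ.filter (· ∈ Γ₀) : Finset (K ≃ₐ[ℚ] K)).card ≠ 2) :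
    weilOrbitChar ℤ (varpiZero p 𝔭 τ₀ h) ≃ₗ[ℤ]
      OrbitTorus.CharModule ℤ ((K ≃ₐ[ℚ] K) ⧸ decompositionGroup p 𝔭) (conjGal : K ≃ₐ[ℚ] K) :=
  OrbitTorus.congr₂ ℤ cmNumbersConj (conjGal : K ≃ₐ[ℚ] K) (orbitVarpiZeroEquivQuotient p 𝔭 τ₀ h hn)
    (orbitVarpiZeroEquivQuotient_conj_smul p 𝔭 τ₀ h hn)

/-- `[δ_π] ↦ [δ_{ρD}]` (`π = σ′ϖ₀`, `σ′|_K = ρ`). [cite: Milne1999, §6 p. 70 L7–L10] -/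
theorem weilOrbitCharEquiv_mk_single (hn : (univ.filter (· ∈ Γ₀) : Finset (K ≃ₐ[ℚ] K)).card ≠ 2)
    (π : MulAction.orbit (cmNumbers ≃ₐ[ℚ] cmNumbers) (varpiZero p 𝔭 τ₀ h)) (r : ℤ) :
    weilOrbitCharEquiv p 𝔭 τ₀ h hn (Submodule.Quotient.mk (Finsupp.single π r)) =
      Submodule.Quotient.mk (Finsupp.single (orbitVarpiZeroEquivQuotient p 𝔭 τ₀ h hn π) r) :=
  OrbitTorus.congr₂_mk_single ℤ _ _ _ _ π r

/-- **`l^Π ↦ l`**: the canonical character `l^Π = [π + ιπ]` of `L^Π` (g15-#3 `lWeil`) goes to the model's `[δ_D + δ_{ιD}]`. [cite: Milne1999, §6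
p. 70 L7–L10; §4 p. 60 L25–L27] -/
theorem weilOrbitCharEquiv_lWeil (hn : (univ.filter (· ∈ Γ₀) : Finset (K ≃ₐ[ℚ] K)).card ≠ 2) :
    weilOrbitCharEquiv p 𝔭 τ₀ h hn (lWeil ℤ (varpiZero p 𝔭 τ₀ h)) =
      OrbitTorus.tChar ℤ (conjGal : K ≃ₐ[ℚ] K) (((1 : K ≃ₐ[ℚ] K)) : (K ≃ₐ[ℚ] K) ⧸ decompositionGroup p 𝔭) := by
  have e1 := orbitVarpiZeroEquivQuotient_apply p 𝔭 τ₀ h hn ⟨varpiZero p 𝔭 τ₀ h, MulAction.mem_orbit_self _⟩ 1 1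
    (by rw [one_smul, embOfAut_one]) (one_smul _ _)
  have e2 := OrbitTorus.congr₂_tChar ℤ cmNumbersConj (conjGal : K ≃ₐ[ℚ] K) (orbitVarpiZeroEquivQuotient p 𝔭 τ₀ h hn)
    (orbitVarpiZeroEquivQuotient_conj_smul p 𝔭 τ₀ h hn) ⟨varpiZero p 𝔭 τ₀ h, MulAction.mem_orbit_self _⟩
  rw [e1] at e2
  exact e2

/-- **Equivariance**: `X^*(L^Π)(K) ≅ X^*(L^Π)(model)` intertwines `Gal(ℚ^{cm}/ℚ)` (g15-#3 `weilOrbitRep`) and `Γ` (Q731 `OrbitTorus.rep`) along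
restriction `σ′ ↦ σ′|_K`. [cite: Milne1999, §6 p. 70 L7–L10] -/
theorem weilOrbitCharEquiv_weilOrbitRep (hn : (univ.filter (· ∈ Γ₀) : Finset (K ≃ₐ[ℚ] K)).card ≠ 2)
    (σ' : cmNumbers ≃ₐ[ℚ] cmNumbers) (ρ : K ≃ₐ[ℚ] K) (hρ : σ' • τ₀ = embOfAut τ₀ ρ) (x : weilOrbitChar ℤ (varpiZero p 𝔭 τ₀ h)) :
    weilOrbitCharEquiv p 𝔭 τ₀ h hn (weilOrbitRep ℤ (varpiZero p 𝔭 τ₀ h) σ' x) =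
      OrbitTorus.rep ℤ ((K ≃ₐ[ℚ] K) ⧸ decompositionGroup p 𝔭) (conjGal : K ≃ₐ[ℚ] K) h.comm ρ (weilOrbitCharEquiv p 𝔭 τ₀ h hn x) :=
  OrbitTorus.congr₂_rep ℤ _ _ _ _ cmNumbersConj_mul_comm h.comm (orbitVarpiZeroEquivQuotient_smul p 𝔭 τ₀ h hn σ' ρ hρ) x

end Orbit

/-! ### §2 `X^*(β^Π)` of `K` IS the model's `X^*(β)`; LEMMA 6.7's conclusion for `K` -/

section Beta

variable {K : Type} [Field K] [NumberField K] [IsCMField K] [IsGalois ℚ K]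
variable (p : ℕ) [hp : Fact p.Prime] (𝔭 : Ideal (𝓞 K)) [h𝔭P : 𝔭.IsPrime] [h𝔭 : 𝔭.LiesOver (Ideal.span {(p : ℤ)})]
variable (τ₀ : K →ₐ[ℚ] cmNumbers)
variable {Γ₀ : Subgroup (K ≃ₐ[ℚ] K)} (h : Setting (conjGal : K ≃ₐ[ℚ] K) Γ₀ (decompositionGroup p 𝔭))
variable [DecidableEq (K ≃ₐ[ℚ] K)] [DecidablePred (· ∈ Γ₀)] [DecidablePred (· ∈ decompositionGroup p 𝔭)]

/-- **`X^*(β^Π)` OF `K` IS THE MODEL'S `X^*(β)`**: for the orbit `Π = Γπ₀`, g16-#7's `X^*(β^Π) : X^*(L^Π) → X^*(P^K)`, `[δ_π] ↦ π`, followed by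
g18-#2's `X^*(P^K) ↪ ℤ[Γ/D]`, `π ↦ f_π`, equals g17-#3's `betaPi : CharModule ℤ (Γ/D) ι → ℤ[Γ/D]`, `[δ_{τD}] ↦ f_{τπ₀}`, after `X^*(L^Π) ≅
CharModule ℤ (Γ/D) ι` — «The map at right sends `π` to the map `σ ↦ f_π(σw₀)`». [cite: Milne1999, §6 p. 70 L5–L12 (Lemma 6.7, bottom arrow)] -/
theorem germToCosetFun_betaCharIn (hn : (univ.filter (· ∈ Γ₀) : Finset (K ≃ₐ[ℚ] K)).card ≠ 2) (x : weilOrbitChar ℤ (varpiZero p 𝔭 τ₀ h)) :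
    germToCosetFun p 𝔭 τ₀ (betaCharIn p τ₀ (varpiZero p 𝔭 τ₀ h) (varpiZero_mem_weilLimitInOnePlus p 𝔭 τ₀ h) x) =
      CosetGerm.betaPi ℤ h two_ne_zero (weilOrbitCharEquiv p 𝔭 τ₀ h hn x) := by
  induction x using Submodule.Quotient.induction_on with | H f => ?_
  induction f using Finsupp.induction_linear with
  | zero => simp only [Submodule.Quotient.mk_zero, map_zero]
  | add f₁ f₂ h₁ h₂ => simp only [Submodule.Quotient.mk_add, map_add, h₁, h₂]
  | single π r =>
    obtain ⟨σ', hσ'⟩ := MulAction.mem_orbit_iff.mp π.2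
    obtain ⟨ρ, hρ⟩ := exists_smul_eq_embOfAut τ₀ σ'
    -- the generator `[δ_π]`, `π = σ′ϖ₀`: both sides are `f_{σ′π₀} = ϖ_ρ`
    have key1 : germToCosetFun p 𝔭 τ₀ (betaCharIn p τ₀ (varpiZero p 𝔭 τ₀ h) (varpiZero_mem_weilLimitInOnePlus p 𝔭 τ₀ h)
        (Submodule.Quotient.mk (Finsupp.single π 1))) =
        CosetGerm.betaPi ℤ h two_ne_zero (weilOrbitCharEquiv p 𝔭 τ₀ h hn (Submodule.Quotient.mk (Finsupp.single π 1))) := by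
      rw [betaCharIn_mk_single, ofMul_eq_weilLimitInRep_piZero p 𝔭 τ₀ h π σ' hσ', germToCosetFun_weilLimitInRep_piZero p 𝔭 τ₀ h σ' ρ hρ,
        weilOrbitCharEquiv_mk_single, orbitVarpiZeroEquivQuotient_apply p 𝔭 τ₀ h hn π σ' ρ hρ hσ', CosetGerm.betaPi_mk_single,
        ← CosetGerm.germ_coe ℤ h, CosetGerm.germ_eq_coe_piGerm, CosetGerm.smul_piGerm, mul_one]
    -- additivity in the coefficient `r`
    let F : ℤ →+ ((K ≃ₐ[ℚ] K) ⧸ decompositionGroup p 𝔭 →₀ ℤ) :=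
      ((germToCosetFun p 𝔭 τ₀).toAddMonoidHom.comp
        (betaCharIn p τ₀ (varpiZero p 𝔭 τ₀ h) (varpiZero_mem_weilLimitInOnePlus p 𝔭 τ₀ h)).toAddMonoidHom).comp
        ((Submodule.mkQ (OrbitTorus.rel ℤ (MulAction.orbit (cmNumbers ≃ₐ[ℚ] cmNumbers) (varpiZero p 𝔭 τ₀ h)) cmNumbersConj)).toAddMonoidHom.comp
          (Finsupp.singleAddHom π))
    let G : ℤ →+ ((K ≃ₐ[ℚ] K) ⧸ decompositionGroup p 𝔭 →₀ ℤ) :=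
      ((CosetGerm.betaPi ℤ h two_ne_zero).toAddMonoidHom.comp (weilOrbitCharEquiv p 𝔭 τ₀ h hn).toLinearMap.toAddMonoidHom).comp
        ((Submodule.mkQ (OrbitTorus.rel ℤ (MulAction.orbit (cmNumbers ≃ₐ[ℚ] cmNumbers) (varpiZero p 𝔭 τ₀ h)) cmNumbersConj)).toAddMonoidHom.comp
          (Finsupp.singleAddHom π))
    have hFG : F = G := AddMonoidHom.ext_int key1
    exact DFunLike.congr_fun hFG r

/-- **LEMMA 6.7's CONCLUSION FOR THE CM FIELD `K`: `X^*(β^Π) : X^*(L^Π) → X^*(P^K)` IS INJECTIVE** for `Π = Γπ₀ ⊂ W^K_{1,+}(p^∞)` the orbit of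
`π₀ = π(ψ₀)` and `n = |Γ₀| ≠ 2` («We shall prove this by showing that the bottom map is injective»; g17-#2/#3 `betaPi_injective` transported:
over `ℤ`, `d ≠ 0` and `2 − n ≠ 0`). [cite: Milne1999, §6 p. 70 Lemma 6.7, L7] -/
theorem betaCharIn_varpiZero_injective (hn : (univ.filter (· ∈ Γ₀) : Finset (K ≃ₐ[ℚ] K)).card ≠ 2) :
    Function.Injective (betaCharIn p τ₀ (varpiZero p 𝔭 τ₀ h) (varpiZero_mem_weilLimitInOnePlus p 𝔭 τ₀ h)) := by
  intro x y e
  have e' := congrArg (germToCosetFun p 𝔭 τ₀) e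
  rw [germToCosetFun_betaCharIn p 𝔭 τ₀ h hn, germToCosetFun_betaCharIn p 𝔭 τ₀ h hn] at e'
  have hd : (Fintype.card (decompositionGroup p 𝔭) : ℤ) ≠ 0 := Nat.cast_ne_zero.2 Fintype.card_ne_zero
  have hn' : (2 : ℤ) - ((univ.filter (· ∈ Γ₀) : Finset (K ≃ₐ[ℚ] K)).card : ℤ) ≠ 0 :=
    sub_ne_zero.2 (by exact_mod_cast (Ne.symm hn))
  exact (weilOrbitCharEquiv p 𝔭 τ₀ h hn).injective (CosetGerm.betaPi_injective ℤ h two_ne_zero hd hn' e')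

end Beta

/-! ### §3 The instance `K = Q·F`, `p` split in `Q`, `[K : Q] ≠ 2` -/

section Split

variable {K : Type} [Field K] [NumberField K] [IsCMField K] [IsGalois ℚ K] (Q : IntermediateField ℚ K)
variable (p : ℕ) [hp : Fact p.Prime] (𝔭 : Ideal (𝓞 K)) [h𝔭P : 𝔭.IsPrime] [h𝔭 : 𝔭.LiesOver (Ideal.span {(p : ℤ)})]
variable (τ₀ : K →ₐ[ℚ] cmNumbers)
variable [DecidableEq (K ≃ₐ[ℚ] K)] [DecidablePred (· ∈ Q.fixingSubgroup)] [DecidablePred (· ∈ decompositionGroup p 𝔭)]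

/-- **LEMMA 6.7's conclusion for `K = Q·F`, `p` split in `Q`, `[K : Q] ≠ 2`**: `X^*(β^Π)` is injective on `X^*(L^Π)`, `Π` the orbit of
`π(ψ₀)`, `Φ₀ = {τ₀} ∪ τ₀ι(Gal(K/Q)∖1)`. [cite: Milne1999, §6 p. 70 Lemma 6.7] -/
theorem betaCharIn_varpiZero_injective_of_split (hQ : Module.finrank ℚ Q = 2) (hQi : ¬IsTotallyReal Q)
    (hsplit : ((Ideal.span {(p : ℤ)}).primesOver (𝓞 Q)).ncard = 2) (hK : Module.finrank Q K ≠ 2) :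
    Function.Injective (betaCharIn p τ₀ (varpiZero p 𝔭 τ₀ (cosetGermSetting Q p 𝔭 hQ hQi hsplit))
      (varpiZero_mem_weilLimitInOnePlus p 𝔭 τ₀ (cosetGermSetting Q p 𝔭 hQ hQi hsplit))) :=
  betaCharIn_varpiZero_injective p 𝔭 τ₀ _ (by rw [card_filter_mem_fixingSubgroup]; exact hK)

end Split

end CMNumbers

end Literature.NumberTheory.ComplexMultiplication
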